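import Literature.NumberTheory.Transcendental.SixExponentialsSeveralVariablesAuxiliary
import Literature.NumberTheory.Transcendental.NesterenkoEliminationNorms
import Mathlib.Algebra.MvPolynomial.Eval
import Mathlib.RingTheory.MvPolynomial.Basic
import HarnessLib

/-!
# The universal auxiliary function with polynomial prefactors (Waldschmidt 1988, Prop. 6.1 — analytic half)

Topic `Literature/NumberTheory/Transcendental`. Everything here is PROVED (two definitions with
bodies, no named facts). This is the first brick of the auxiliary function of
[Waldschmidt1988, §6 Proposition 6.1] for the linear group `𝔾ₐ^{d₀} × 𝔾ₘ^{d₁}` — the hypothesis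
`hAF` of `Literature.NumberTheory.Transcendental.LinGroup.weakObstruction_of_zeroEstimate_of_auxiliary`
(`LinearSubgroupTheoremAssembly.lean`), one of the two results still owed to the named fact
`Literature.Barriers.Schanuel.roy1992_thm1`. In print Proposition 6.1 "is proved in [15]
Proposition 2.4 in the case `W = 0` and `b = 1`" ([Waldschmidt1983]); the method is the
"fonction auxiliaire générale" of [Waldschmidt1981, §3 Théorème 3.1], already formalised in the
tree for pure exponential polynomials (`Waldschmidt1981.cor_3_2_holds`,
`SixExponentialsSeveralVariablesAuxiliary.lean`, whose box principle and truncation lemmas are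
reused here). The new point is the additive factor `𝔾ₐ^{d₀}`: restricted to an `n`-parameter
subgroup, the monomials `X^a Y^b ∘ exp_G` are exponentials `e^{⟨c_λ, ζ⟩}` MULTIPLIED BY POLYNOMIAL
PREFACTORS `Q_λ(ζ)` (powers of linear forms). We prove the analytic statement in that generality:

* (private) `|P(ζ)| ≤ ‖P‖₁` on the unit polydisc for the `ℓ¹`-norm
  `Nesterenko.l1Norm P = ∑_ν ‖coeff_ν P‖` of `NesterenkoEliminationNorms.lean` (whose
  submultiplicativity `l1Norm_mul_le`, `l1Norm_prod_le`, … and `maxNorm_le_l1Norm` are reused);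
* `truncExpForm c T = ∏_m ∑_{k<T} (c_m X_m)^k/k!` — the truncated exponential of a linear form, with
  `eval_truncExpForm`, `l1Norm_truncExpForm_le` (`≤ e^{nρ}`), `degreeOf_truncExpForm_le` (`< T`);
* **`exists_small_universal`** — for `F(ζ) = ∑_λ p_λ Q_λ(ζ) e^{⟨c_λ, ζ⟩}` with `‖Q_λ‖₁ ≤ G₀`,
  `deg_{ζ_m} Q_λ < E`, `‖c_{λ,m}‖ ≤ ρ`, `8ρ ≤ T`, and the count `k^{2(E+T)ⁿ} < (P+1)^{#Λ}`, there are
  integers `p_λ`, not all zero, `|p_λ| ≤ P`, such that on the unit polydisc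
  `|F(ζ)| ≤ (E+T)ⁿ · 2(2 #Λ G₀ e^{nρ} P + 1)/k + #Λ P G₀ n e^{nρ} 2e^{−T}`: Dirichlet's box principle
  (`Waldschmidt1981.box_principle_complex`) on the coefficients of the polynomial
  `∑_λ p_λ Q_λ · truncExpForm c_λ` (all bounded by `‖Q_λ‖₁ ‖Trunc‖₁ ≤ G₀ e^{nρ}`, `maxNorm_le_l1Norm`),
  plus the truncation error `|Q_λ(ζ)| ‖e^{⟨c,ζ⟩} − Trunc(ζ)‖ ≤ G₀ n e^{nρ} 2e^{−T}`
  (`Waldschmidt1981.norm_prod_exp_sub_prod_partialSum_le`). The radius is normalised to `1`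
  (the caller rescales `ζ ↦ Rζ`, putting `R` into `Q_λ` and `c_λ`).

## References

* [Waldschmidt1988] M. Waldschmidt, *On the transcendence methods of Gel'fond and Schneider in
  several variables*, New Advances in Transcendence Theory (A. Baker ed.), CUP 1988, 375–398,
  §6 Proposition 6.1 (p. 389).
* [Waldschmidt1981] M. Waldschmidt, *Transcendance et exponentielles en plusieurs variables*,
  Invent. Math. 63 (1981) 97–127, §3 Théorème 3.1, Corollaire 3.2 (pp. 100–102).
* [Waldschmidt1983] M. Waldschmidt, *Sous-groupes analytiques de groupes algébriques*, Ann. of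
  Math. 117 (1983) 627–657, Proposition 2.4 (cited by [Waldschmidt1988]; not held, acq-02549).
-/

noncomputable section

open MvPolynomial Complex Finset

namespace Literature.NumberTheory.Transcendental

open Nesterenko

/-! ### Evaluation bound on the unit polydisc for the `ℓ¹`-norm `Nesterenko.l1Norm`

Private copies of `Nesterenko.norm_coeff_le_l1Norm` (`NesterenkoCoeffNorms.lean`) and
`Nesterenko.norm_eval_le_l1Norm` (`NesterenkoUResultantSkewPoint.lean`): those two files sit on
top of the whole Chow-form / `u`-resultant development of LNM 1752 Ch. 3, which this elementary
file does not import; being `private`, the copies cannot clash with the originals downstream. -/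

section L1

variable {σ : Type*}

/-- A coefficient is bounded by `‖P‖₁` (private copy of `Nesterenko.norm_coeff_le_l1Norm`).
[folklore] -/
private theorem norm_coeff_le_l1Norm' (P : MvPolynomial σ ℂ) (ν : σ →₀ ℕ) :
    ‖P.coeff ν‖ ≤ l1Norm P :=
  (norm_coeff_le_maxNorm P ν).trans (maxNorm_le_l1Norm P)

/-- On the unit polydisc, `|P(ζ)| ≤ ‖P‖₁` (private copy of `Nesterenko.norm_eval_le_l1Norm`).
[folklore] -/
private theorem norm_eval_le_l1Norm' (P : MvPolynomial σ ℂ) {ζ : σ → ℂ} (hζ : ∀ i, ‖ζ i‖ ≤ 1) :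
    ‖MvPolynomial.eval ζ P‖ ≤ l1Norm P := by
  rw [MvPolynomial.eval_eq, l1Norm]
  refine (norm_sum_le _ _).trans (Finset.sum_le_sum fun ν _ => ?_)
  rw [norm_mul]
  refine mul_le_of_le_one_right (norm_nonneg _) ?_
  rw [norm_prod]
  refine Finset.prod_le_one (fun _ _ => norm_nonneg _) fun i _ => ?_
  rw [norm_pow]
  exact pow_le_one₀ (norm_nonneg _) (hζ i)

end L1

/-! ### The truncated exponential as a polynomial -/

section Trunc

variable {n : ℕ}

/-- The truncated exponential series of the linear form `c · X`:
`Trunc_c = ∏_m ∑_{k<T} (c_m X_m)^k / k!`, a polynomial of degree `< T` in each variable. [folklore] -/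
def truncExpForm (c : Fin n → ℂ) (T : ℕ) : MvPolynomial (Fin n) ℂ :=
  ∏ m, ∑ k : Fin T, C (c m ^ (k : ℕ) / ((k : ℕ).factorial : ℂ)) * X m ^ (k : ℕ)

/-- `Trunc_c(ζ) = ∏_m ∑_{k<T} (c_m ζ_m)^k/k!`. [folklore] -/
theorem eval_truncExpForm (c : Fin n → ℂ) (T : ℕ) (ζ : Fin n → ℂ) :
    MvPolynomial.eval ζ (truncExpForm c T) =
      ∏ m, ∑ k : Fin T, (c m * ζ m) ^ (k : ℕ) / ((k : ℕ).factorial : ℂ) := by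
  simp only [truncExpForm, map_prod, map_sum, map_mul, eval_C, map_pow, eval_X]
  refine Finset.prod_congr rfl fun m _ => Finset.sum_congr rfl fun k _ => ?_
  rw [mul_pow]
  ring

/-- `‖Trunc_c‖₁ ≤ e^{nρ}` when `‖c_m‖ ≤ ρ`. [folklore] -/
theorem l1Norm_truncExpForm_le (c : Fin n → ℂ) (T : ℕ) {ρ : ℝ} (hc : ∀ m, ‖c m‖ ≤ ρ) :
    l1Norm (truncExpForm c T) ≤ Real.exp ρ ^ n := by
  classical
  rw [truncExpForm]
  refine (l1Norm_prod_le _ _).trans ?_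
  have hbound : ∀ m : Fin n, l1Norm (∑ k : Fin T, C (c m ^ (k : ℕ) / ((k : ℕ).factorial : ℂ)) *
      X m ^ (k : ℕ)) ≤ Real.exp ρ := fun m => ?_
  · calc ∏ m, l1Norm (∑ k : Fin T, C (c m ^ (k : ℕ) / ((k : ℕ).factorial : ℂ)) * X m ^ (k : ℕ))
        ≤ ∏ _m : Fin n, Real.exp ρ := Finset.prod_le_prod (fun _ _ => l1Norm_nonneg _) fun m _ => hbound m
      _ = Real.exp ρ ^ n := by simp
  refine (l1Norm_sum_le _ _).trans ?_
  calc ∑ k : Fin T, l1Norm (C (c m ^ (k : ℕ) / ((k : ℕ).factorial : ℂ)) * X m ^ (k : ℕ))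
      ≤ ∑ k : Fin T, ‖c m‖ ^ (k : ℕ) / (k : ℕ).factorial := by
        refine Finset.sum_le_sum fun k _ => ?_
        calc l1Norm (C (c m ^ (k : ℕ) / ((k : ℕ).factorial : ℂ)) * X m ^ (k : ℕ))
            ≤ l1Norm (C (c m ^ (k : ℕ) / ((k : ℕ).factorial : ℂ))) * l1Norm (X m ^ (k : ℕ)) :=
              l1Norm_mul_le _ _
          _ ≤ ‖c m ^ (k : ℕ) / ((k : ℕ).factorial : ℂ)‖ * 1 := by
              refine mul_le_mul (l1Norm_C _).le ?_ (l1Norm_nonneg _) (norm_nonneg _)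
              exact (l1Norm_pow_le _ _).trans (pow_le_one₀ (l1Norm_nonneg _) (l1Norm_X _).le)
          _ = ‖c m‖ ^ (k : ℕ) / (k : ℕ).factorial := by
              rw [mul_one, norm_div, norm_pow, Complex.norm_natCast]
    _ ≤ Real.exp ‖c m‖ := by
        rw [Finset.sum_fin_eq_sum_range]
        calc ∑ k ∈ Finset.range T, (if h : k < T then ‖c m‖ ^ k / k.factorial else 0)
            = ∑ k ∈ Finset.range T, ‖c m‖ ^ k / k.factorial :=
              Finset.sum_congr rfl fun k hk => by rw [dif_pos (Finset.mem_range.1 hk)]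
          _ ≤ Real.exp ‖c m‖ := Real.sum_le_exp_of_nonneg (norm_nonneg _) _
    _ ≤ Real.exp ρ := Real.exp_le_exp.2 (hc m)

/-- `deg_{X_i} Trunc_c ≤ T - 1`. [folklore] -/
theorem degreeOf_truncExpForm_le (c : Fin n → ℂ) (T : ℕ) (i : Fin n) :
    (truncExpForm c T).degreeOf i ≤ T - 1 := by
  classical
  rw [truncExpForm]
  refine (degreeOf_prod_le _ _ _).trans ?_
  have hterm : ∀ m, ((∑ k : Fin T, C (c m ^ (k : ℕ) / ((k : ℕ).factorial : ℂ)) * X m ^ (k : ℕ)) :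
      MvPolynomial (Fin n) ℂ).degreeOf i ≤ if m = i then T - 1 else 0 := by
    intro m
    refine (degreeOf_sum_le _ _ _).trans (Finset.sup_le fun k _ => ?_)
    refine (degreeOf_C_mul_le _ _ _).trans ?_
    by_cases hmi : m = i
    · subst hmi
      rw [if_pos rfl]
      refine (degreeOf_pow_le _ _ _).trans ?_
      have hX : (X m : MvPolynomial (Fin n) ℂ).degreeOf m ≤ 1 := by
        rw [degreeOf_X_self]
      calc (k : ℕ) * (X m : MvPolynomial (Fin n) ℂ).degreeOf m ≤ (k : ℕ) * 1 :=
            Nat.mul_le_mul_left _ hX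
        _ ≤ T - 1 := by have := k.2; omega
    · rw [if_neg hmi, degreeOf_X_pow_of_ne _ (Ne.symm hmi)]
  calc ∑ m, ((∑ k : Fin T, C (c m ^ (k : ℕ) / ((k : ℕ).factorial : ℂ)) * X m ^ (k : ℕ)) :
        MvPolynomial (Fin n) ℂ).degreeOf i
      ≤ ∑ m : Fin n, (if m = i then T - 1 else 0) := Finset.sum_le_sum fun m _ => hterm m
    _ = T - 1 := by rw [Finset.sum_ite_eq']; simp

end Trunc

/-! ### The universal auxiliary function with polynomial prefactors -/

section Universal

variable {n : ℕ} {Λ : Type*} [Fintype Λ]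

/-- **The universal auxiliary function (analytic half of [Waldschmidt1988, Prop. 6.1], in the
style of [Waldschmidt1981, §3 Théorème 3.1]).** Let `F(ζ) = ∑_λ p_λ Q_λ(ζ) e^{⟨c_λ, ζ⟩}` on the
unit polydisc of `ℂⁿ`, with prefactors `Q_λ` of `ℓ¹`-norm `≤ G₀` and degree `< E` in each
variable, and frequencies `‖c_{λ,m}‖ ≤ ρ`. If `8ρ ≤ T` and `k^{2(E+T)ⁿ} < (P+1)^{#Λ}`, there are
integers `p_λ`, not all zero, `|p_λ| ≤ P`, with
`|F(ζ)| ≤ (E+T)ⁿ · 2(2 #Λ G₀ e^{nρ} P + 1)/k + #Λ P G₀ n e^{nρ} 2e^{−T}` for `‖ζ‖ ≤ 1`: the box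
principle (`Waldschmidt1981.box_principle_complex`) makes all coefficients of the polynomial
`∑_λ p_λ Q_λ Trunc_{c_λ}` small, and the truncation error is
`|Q_λ(ζ)| · ‖e^{⟨c,ζ⟩} − Trunc_c(ζ)‖ ≤ G₀ n e^{nρ} 2e^{−T}`
(`Waldschmidt1981.norm_prod_exp_sub_prod_partialSum_le`).
[cite: Waldschmidt1988, §6 Proposition 6.1 (p. 389)]
[cite: Waldschmidt1981, §3 Théorème 3.1 (pp. 100–101)] -/
theorem exists_small_universal [DecidableEq Λ] (Q : Λ → MvPolynomial (Fin n) ℂ)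
    (c : Λ → Fin n → ℂ) {E T : ℕ} {G₀ ρ : ℝ} (hG₀ : 0 ≤ G₀) (hρ : 0 ≤ ρ)
    (hQ1 : ∀ l, l1Norm (Q l) ≤ G₀) (hQdeg : ∀ l m, (Q l).degreeOf m < E)
    (hc : ∀ l m, ‖c l m‖ ≤ ρ) (hT : 8 * ρ ≤ T) (hT1 : 1 ≤ T)
    (Pb k : ℕ) (hk : 0 < k) (hcard : k ^ (2 * (E + T) ^ n) < (Pb + 1) ^ Fintype.card Λ) :
    ∃ p : Λ → ℤ, p ≠ 0 ∧ (∀ l, |p l| ≤ Pb) ∧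
      ∀ ζ : Fin n → ℂ, (∀ m, ‖ζ m‖ ≤ 1) →
        ‖∑ l, (p l : ℂ) * (MvPolynomial.eval ζ (Q l) * cexp (∑ m, c l m * ζ m))‖ ≤
          ((E + T : ℕ) : ℝ) ^ n * (2 * ((2 * Fintype.card Λ * (G₀ * Real.exp ρ ^ n) * Pb + 1) / k))
            + Fintype.card Λ * Pb * (G₀ * (n * Real.exp ρ ^ n * (2 * Real.exp (-T)))) := by
  classical
  -- the polynomials `G_λ = Q_λ · Trunc_{c_λ}`
  set G : Λ → MvPolynomial (Fin n) ℂ := fun l => Q l * truncExpForm (c l) T with hG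
  have hG1 : ∀ l, l1Norm (G l) ≤ G₀ * Real.exp ρ ^ n := fun l =>
    (l1Norm_mul_le _ _).trans (mul_le_mul (hQ1 l) (l1Norm_truncExpForm_le _ _ (hc l)) (l1Norm_nonneg _) hG₀)
  have hGdeg : ∀ l m, (G l).degreeOf m < E + T := by
    intro l m
    have h1 := hQdeg l m
    have h2 := degreeOf_truncExpForm_le (c l) T m
    have h3 : (G l).degreeOf m ≤ (Q l).degreeOf m + (truncExpForm (c l) T).degreeOf m :=
      degreeOf_mul_le m _ _
    omega
  -- rows `ν : Fin n → Fin (E+T)`, entries `coeff_ν G_λ`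
  let toF : (Fin n → Fin (E + T)) → (Fin n →₀ ℕ) := fun ν =>
    Finsupp.equivFunOnFinite.symm fun m => (ν m : ℕ)
  set a : (Fin n → Fin (E + T)) → Λ → ℂ := fun ν l => (G l).coeff (toF ν) with ha
  have hA : ∀ ν l, ‖a ν l‖ ≤ G₀ * Real.exp ρ ^ n := fun ν l =>
    (norm_coeff_le_l1Norm' _ _).trans (hG1 l)
  have hA0 : 0 ≤ G₀ * Real.exp ρ ^ n := by positivity
  have hcard' : k ^ (2 * Fintype.card (Fin n → Fin (E + T))) < (Pb + 1) ^ Fintype.card Λ := by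
    rwa [Fintype.card_fun, Fintype.card_fin, Fintype.card_fin]
  obtain ⟨p, hp0, hpP, hpL⟩ := Waldschmidt1981.box_principle_complex a hA0 hA Pb k hk hcard'
  refine ⟨p, hp0, hpP, fun ζ hζ => ?_⟩
  set ε : ℝ := 2 * ((2 * Fintype.card Λ * (G₀ * Real.exp ρ ^ n) * Pb + 1) / k) with hε
  -- the main term: the polynomial `∑ p_λ G_λ` has all coefficients `≤ ε` and degree `< E+T`
  set H : MvPolynomial (Fin n) ℂ := ∑ l, (p l : ℂ) • G l with hH
  have hHcoeff : ∀ ν : Fin n → Fin (E + T), ‖H.coeff (toF ν)‖ ≤ ε := by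
    intro ν
    have e : H.coeff (toF ν) = ∑ l, (p l : ℂ) * a ν l := by
      rw [hH, coeff_sum]
      exact Finset.sum_congr rfl fun l _ => by rw [coeff_smul, smul_eq_mul]
    rw [e]
    exact hpL ν
  have hHsupp : ∀ ν ∈ H.support, ∀ m, ν m < E + T := by
    intro ν hν m
    have hdeg : H.degreeOf m < E + T := by
      refine lt_of_le_of_lt (degreeOf_sum_le _ _ _) ?_
      refine (Finset.sup_lt_iff (show (⊥ : ℕ) < E + T by rw [bot_eq_zero]; omega)).2
        fun l _ => ?_
      have hsm : ((p l : ℂ) • G l).degreeOf m ≤ (G l).degreeOf m := by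
        rw [smul_eq_C_mul]
        exact degreeOf_C_mul_le _ _ _
      exact lt_of_le_of_lt hsm (hGdeg l m)
    exact (degreeOf_lt_iff (by omega)).1 hdeg ν hν
  have hHeval : ‖MvPolynomial.eval ζ H‖ ≤ ((E + T : ℕ) : ℝ) ^ n * ε := by
    -- `H(ζ) = ∑_{ν ∈ supp} coeff_ν ζ^ν`, `supp ⊆ image of the rows`
    rw [MvPolynomial.eval_eq]
    have hsub : H.support ⊆ Finset.univ.image toF := by
      intro ν hν
      refine Finset.mem_image.2 ⟨fun m => ⟨ν m, hHsupp ν hν m⟩, Finset.mem_univ _, ?_⟩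
      ext m
      rfl
    calc ‖∑ ν ∈ H.support, H.coeff ν * ∏ m ∈ ν.support, ζ m ^ ν m‖
        ≤ ∑ ν ∈ H.support, ‖H.coeff ν * ∏ m ∈ ν.support, ζ m ^ ν m‖ := norm_sum_le _ _
      _ ≤ ∑ ν ∈ Finset.univ.image toF, ‖H.coeff ν * ∏ m ∈ ν.support, ζ m ^ ν m‖ :=
          Finset.sum_le_sum_of_subset_of_nonneg hsub fun _ _ _ => norm_nonneg _
      _ ≤ ∑ _ν ∈ Finset.univ.image toF, ε := by
          refine Finset.sum_le_sum fun ν hν => ?_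
          obtain ⟨ν', -, rfl⟩ := Finset.mem_image.1 hν
          rw [norm_mul]
          refine (mul_le_of_le_one_right (norm_nonneg _) ?_).trans (hHcoeff ν')
          rw [norm_prod]
          exact Finset.prod_le_one (fun _ _ => norm_nonneg _) fun m _ => by
            rw [norm_pow]; exact pow_le_one₀ (norm_nonneg _) (hζ m)
      _ = (Finset.univ.image toF).card * ε := by rw [Finset.sum_const, nsmul_eq_mul]
      _ ≤ ((E + T : ℕ) : ℝ) ^ n * ε := by
          have hεpos : 0 ≤ ε := by rw [hε]; positivity
          refine mul_le_mul_of_nonneg_right ?_ hεpos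
          have h1 : (Finset.univ.image toF).card ≤ Fintype.card (Fin n → Fin (E + T)) :=
            Finset.card_image_le.trans (by rw [Finset.card_univ])
          rw [Fintype.card_fun, Fintype.card_fin, Fintype.card_fin] at h1
          exact_mod_cast h1
  -- the error term
  have herr : ∀ l, ‖(p l : ℂ) * (MvPolynomial.eval ζ (Q l) *
      (cexp (∑ m, c l m * ζ m) - MvPolynomial.eval ζ (truncExpForm (c l) T)))‖ ≤
      Pb * (G₀ * (n * Real.exp ρ ^ n * (2 * Real.exp (-T)))) := by
    intro l
    rw [norm_mul, norm_mul]
    have hp' : ‖(p l : ℂ)‖ ≤ Pb := by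
      rw [Complex.norm_intCast]; exact_mod_cast hpP l
    have hQ' : ‖MvPolynomial.eval ζ (Q l)‖ ≤ G₀ := (norm_eval_le_l1Norm' _ hζ).trans (hQ1 l)
    have hexp : ‖cexp (∑ m, c l m * ζ m) - MvPolynomial.eval ζ (truncExpForm (c l) T)‖ ≤
        n * Real.exp ρ ^ n * (2 * Real.exp (-T)) := by
      rw [Complex.exp_sum, eval_truncExpForm]
      have h := Waldschmidt1981.norm_prod_exp_sub_prod_partialSum_le Finset.univ
        (fun m => c l m * ζ m) hρ (fun m _ => ?_) hT hT1
      · simpa only [Finset.card_univ, Fintype.card_fin] using h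
      · rw [norm_mul]
        calc ‖c l m‖ * ‖ζ m‖ ≤ ρ * 1 := mul_le_mul (hc l m) (hζ m) (norm_nonneg _) hρ
          _ = ρ := mul_one ρ
    exact mul_le_mul hp' (mul_le_mul hQ' hexp (norm_nonneg _) hG₀)
      (mul_nonneg (norm_nonneg _) (norm_nonneg _)) (Nat.cast_nonneg _)
  -- assemble: `F = H(ζ) + ∑ p_λ Q_λ (e - Trunc)`
  have hsplit : ∑ l, (p l : ℂ) * (MvPolynomial.eval ζ (Q l) * cexp (∑ m, c l m * ζ m)) =
      MvPolynomial.eval ζ H + ∑ l, (p l : ℂ) * (MvPolynomial.eval ζ (Q l) *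
        (cexp (∑ m, c l m * ζ m) - MvPolynomial.eval ζ (truncExpForm (c l) T))) := by
    rw [hH, map_sum, ← Finset.sum_add_distrib]
    refine Finset.sum_congr rfl fun l _ => ?_
    rw [smul_eval, hG, map_mul]
    ring
  rw [hsplit]
  refine (norm_add_le _ _).trans (add_le_add hHeval ?_)
  calc ‖∑ l, (p l : ℂ) * (MvPolynomial.eval ζ (Q l) *
        (cexp (∑ m, c l m * ζ m) - MvPolynomial.eval ζ (truncExpForm (c l) T)))‖
      ≤ ∑ l, ‖(p l : ℂ) * (MvPolynomial.eval ζ (Q l) *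
        (cexp (∑ m, c l m * ζ m) - MvPolynomial.eval ζ (truncExpForm (c l) T)))‖ := norm_sum_le _ _
    _ ≤ ∑ _l : Λ, (Pb : ℝ) * (G₀ * (n * Real.exp ρ ^ n * (2 * Real.exp (-T)))) :=
        Finset.sum_le_sum fun l _ => herr l
    _ = Fintype.card Λ * Pb * (G₀ * (n * Real.exp ρ ^ n * (2 * Real.exp (-T)))) := by
        rw [Finset.sum_const, Finset.card_univ, nsmul_eq_mul]
        ring

end Universal

end Literature.NumberTheory.Transcendental
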